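import Summits.ResolutionOfSingularities.ResolutionOfSingularities.Theorems.HomologicalConductorNoZenoTraceSocleTerminator
import Summits.ResolutionOfSingularities.ResolutionOfSingularities.Theorems.HomologicalConductorStrictDropTowerShape
import Literature.AlgebraicGeometry.Resolution.QuadraticTransformsRegular
import Literature.AlgebraicGeometry.Resolution.QuadraticTransformsProofs
import HarnessLib

/-!
# Crux `NoZenoR` / `NoZeno` (stmt-ResolutionOfSingularities-19943 / -16483), β1ʳ¹♯ layer:
# NOETHERIAN CAPTURE (port of ideator res-L0-w44-idea-1's card 12 `generic-fibre-ladder`, Sketch r13 §r13.1, §r13.4)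

`[OURS · L W4.4]` Cell res-hironaka, crux chain W4.4.  Tree port (seat res-L0-w44-stub-1 g9, CHAIN v23 row stub-1 /
plan-1 (ρ37i) «HOIST idea-1 card 12's PROVED theorems») of `L/res-L0-w44-idea-1/Sketch-idea-1-r13.lean` (sha16
`1301e7a2059ff799`, farm rc 0 · 0 sorries), AUTHOR res-L0-w44-idea-1 g13 (technique A: value-group monotonicity /
rank-one coarsening); statements and proofs are the ideator's, re-homed under `…Theorems.NoZeno.NoetherianCapture`.
Nothing here is a statement of the manuscript under review (Hironaka 2017); AI-written, weaker than expert review;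
support-level, counted 0.  Companion file: `…NoZenoGenericFibreStage` (§r13.2, the generic-fibre regular rings that
are the natural candidates for the capturing ring on branch (b) of β1ʳ¹♯).

THE LEVER (ideator's words, abridged).  The terminator that consumes a noetherian subring of `O` is NOETHERIAN
CAPTURE: under `StrictDrop`, ONE noetherian `N ≤ O` containing the cohomology annihilators `ca(T_m)` of all late
stages forces a regular stage — were no stage regular, the separated StrictDrop witnesses `y_i ∈ ca(T_{m_i}) ⊆ N`
(`y_{i+1} / y_i ∉ O`) would give a STRICTLY increasing chain of ideals `{x ∈ N | x / y_i ∈ O}` of `N`.  Rank-free,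
branch-free, thread-free; `PersistenceRadical` is not used.

* `terminates_of_noetherianCapture` (§r13.1, THM NC) and its `Subalgebra` form; `conductors_escape` (the
  contrapositive: with no regular stage the late conductors leave every noetherian subring of `O`);
  `capture_of_isRegularLocalRing_tower` (the converse: a regular stage is a noetherian subring of `O` capturing
  every later stage, the tower being stationary after it — `tower_eq_of_le_of_isRegularLocalRing`).
* §r13.4 THE LADDER, made UNCONDITIONAL here (the sketch kept Abhyankar's union lemma as the named-fact binder
  `AbhyankarQuadraticUnion`; the tree PROVES it: `AbhyankarQuadraticUnion_holds`, and proves the rungs regular: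
  `isRegularLocalRing_sequence`): along the quadratic sequence `R_0 → R_1 → ⋯` along `O` of a two-dimensional
  regular local ring `R_0 ∋ k` of `K` dominated by `O`, EVERY stage `T_m` lies in some rung
  (`stage_captured_by_rung`, the CAPTURE INDEX is defined), and under `StrictDrop` the tower has a regular stage
  iff ONE rung contains all late stages (`terminates_iff_boundedCaptureIndex`).

References: S. D. Cutkosky, *Counterexamples to local monomialization in positive characteristic* (2014/15),
Lemma 2.2 [`Cutkosky2014`] = S. Abhyankar, *On the valuations centered in a local domain* (1956), Lemma 12 and
Prop. 8 [`Abhyankar1956Valuations`] (via the tree's `AbhyankarQuadraticUnion_holds`, `isRegularLocalRing_sequence`).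
-/

noncomputable section

-- single-problem summit: the doubled namespace component `ResolutionOfSingularities` is forced
set_option linter.dupNamespace false

namespace Summit.ResolutionOfSingularities.ResolutionOfSingularities.Theorems.NoZeno.NoetherianCapture

open Summit.ResolutionOfSingularities.ResolutionOfSingularities.Theses.HomologicalConductor
open Summit.ResolutionOfSingularities.ResolutionOfSingularities.Theorems.NoZeno.Birth
open Summit.ResolutionOfSingularities.ResolutionOfSingularities.Theorems
open Summit.ResolutionOfSingularities.ResolutionOfSingularities.Theorems.NoZeno
open Literature.AlgebraicGeometry.Resolution
open IsLocalRing

variable {k K : Type} [Field k] [Field K] [Algebra k K]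

/-! ## Tower plumbing -/

/-- After a regular stage the tower is stationary: `T_{m'} = T_m` for all `m' ≥ m`.
[tree `tower_succ_eq_self_of_isRegularLocalRing`; folklore] -/
theorem tower_eq_of_le_of_isRegularLocalRing (O : ValuationSubring K) (A : Subalgebra k K)
    (hk : ∀ c : k, algebraMap k K c ∈ O) (hfr : IsFractionRing ↥A K) (hAO : A.toSubring ≤ O.toSubring)
    (m : ℕ) (hreg : IsRegularLocalRing ↥(tower O A m)) :
    ∀ m' : ℕ, m ≤ m' → tower O A m' = tower O A m := by
  intro m' hm'
  induction m', hm' using Nat.le_induction with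
  | base => rfl
  | succ n hmn ih =>
    rw [← ih]
    refine tower_succ_eq_self_of_isRegularLocalRing O A hk hfr hAO n ?_
    rw [ih]; exact hreg

/-! ## §r13.1 NOETHERIAN CAPTURE: one noetherian subring of `O` containing the late conductors terminates a
StrictDrop tower -/

/-- **NOETHERIAN CAPTURE (THM NC; rank-free, branch-free, thread-free).**  If `StrictDrop` holds and some
noetherian subring `N ⊆ O` contains `ca(T_m)` for all `m ≥ m₀`, then some stage of the canonical normalised
`ca`-tower is a regular local ring.  Proof: were no stage regular, StrictDrop would give `y_0, y_1, … ∈ N ∖ 0`,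
`y_i ∈ ca(T_{m_i})`, `m₀ ≤ m_0 < m_1 < …`, with `y_{i+1} / y_i ∉ O`; then `y_i / y_{i+1} ∈ O` and the ideals
`I_i = {x ∈ N | x / y_i ∈ O}` of `N` increase STRICTLY (`y_{i+1} ∈ I_{i+1} ∖ I_i`) — against the ascending chain
condition. [OURS: ideator res-L0-w44-idea-1, Sketch r13 §r13.1; folklore ingredients] -/
theorem terminates_of_noetherianCapture (hD : StrictDrop) (p : ℕ) (hp : p.Prime) (k K : Type) [Field k]
    [CharP k p] [Field K] [Algebra k K] (O : ValuationSubring K) (A : Subalgebra k K)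
    (hk : ∀ c : k, algebraMap k K c ∈ O) (hA : A.FG) (hfr : IsFractionRing ↥A K)
    (hAO : A.toSubring ≤ O.toSubring) (N : Subring K) (hN : IsNoetherianRing ↥N)
    (hNO : N ≤ O.toSubring) (m₀ : ℕ)
    (hcap : ∀ m : ℕ, m₀ ≤ m → ∀ x ∈ ca (tower O A m), x ∈ N) :
    ∃ m : ℕ, IsRegularLocalRing ↥(tower O A m) := by
  classical
  by_contra hnone
  push Not at hnone
  have hdrop : ∀ m : ℕ, ¬ IsRegularLocalRing ↥(tower O A m) → ∃ m' : ℕ, m < m' ∧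
      ∃ y ∈ ca (tower O A m'), y ≠ 0 ∧ ∀ x ∈ ca (tower O A m), x ≠ 0 → y * x⁻¹ ∉ O :=
    hD p hp k K O A hk hA hfr hAO
  -- late StrictDrop witnesses and the separated successor of each
  have step : ∀ q : {q : ℕ × K // m₀ ≤ q.1 ∧ q.2 ∈ ca (tower O A q.1) ∧ q.2 ≠ 0},
      ∃ q' : {q : ℕ × K // m₀ ≤ q.1 ∧ q.2 ∈ ca (tower O A q.1) ∧ q.2 ≠ 0},
        q'.1.2 * (q.1.2)⁻¹ ∉ O := by
    rintro ⟨⟨m, y⟩, hm, hy, hy0⟩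
    obtain ⟨m', hmm', y', hy', hy'0, hsep⟩ := hdrop m (hnone m)
    exact ⟨⟨⟨m', y'⟩, le_trans hm hmm'.le, hy', hy'0⟩, hsep y hy hy0⟩
  choose f hf using step
  obtain ⟨m₁, hm₁, y₁, hy₁, hy₁0, -⟩ := hdrop m₀ (hnone m₀)
  let q₀ : {q : ℕ × K // m₀ ≤ q.1 ∧ q.2 ∈ ca (tower O A q.1) ∧ q.2 ≠ 0} :=
    ⟨⟨m₁, y₁⟩, hm₁.le, hy₁, hy₁0⟩
  let s : ℕ → {q : ℕ × K // m₀ ≤ q.1 ∧ q.2 ∈ ca (tower O A q.1) ∧ q.2 ≠ 0} := fun n => f^[n] q₀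
  have hs : ∀ n, s (n + 1) = f (s n) := fun n => Function.iterate_succ_apply' f n q₀
  let y : ℕ → K := fun n => (s n).1.2
  have hyN : ∀ n, y n ∈ N := fun n => hcap _ (s n).2.1 _ (s n).2.2.1
  have hy0 : ∀ n, y n ≠ 0 := fun n => (s n).2.2.2
  have hsep : ∀ n, y (n + 1) * (y n)⁻¹ ∉ O := fun n => by
    show (s (n + 1)).1.2 * ((s n).1.2)⁻¹ ∉ O
    rw [hs]; exact hf (s n)
  have hdiv : ∀ n, y n * (y (n + 1))⁻¹ ∈ O := fun n => by
    rcases O.mem_or_inv_mem (y (n + 1) * (y n)⁻¹) with h | h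
    · exact absurd h (hsep n)
    · rw [mul_inv_rev, inv_inv] at h; exact h
  -- the increasing ideals `I n = {x ∈ N | x / y n ∈ O}`
  let I : ℕ → Ideal ↥N := fun n =>
    { carrier := {x | (x : K) * (y n)⁻¹ ∈ O}
      add_mem' := fun {a b} ha hb => by
        simp only [Set.mem_setOf_eq, Subring.coe_add, add_mul] at ha hb ⊢
        exact O.add_mem _ _ ha hb
      zero_mem' := by simp only [Set.mem_setOf_eq, Subring.coe_zero, zero_mul]; exact O.zero_mem
      smul_mem' := fun c {x} hx => by
        simp only [Set.mem_setOf_eq, smul_eq_mul, Subring.coe_mul, mul_assoc] at hx ⊢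
        exact O.mul_mem _ _ (hNO c.2) hx }
  have hmono : Monotone I := monotone_nat_of_le_succ fun n => fun x hx => by
    change (x : K) * (y (n + 1))⁻¹ ∈ O
    have hx' : (x : K) * (y n)⁻¹ ∈ O := hx
    have : (x : K) * (y (n + 1))⁻¹ = ((x : K) * (y n)⁻¹) * (y n * (y (n + 1))⁻¹) := by
      rw [mul_assoc, inv_mul_cancel_left₀ (hy0 n)]
    rw [this]; exact O.mul_mem _ _ hx' (hdiv n)
  haveI : IsNoetherian ↥N ↥N := hN
  obtain ⟨n, hn⟩ := monotone_stabilizes_iff_noetherian.2 ‹IsNoetherian ↥N ↥N› ⟨I, hmono⟩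
  have hmem : (⟨y (n + 1), hyN (n + 1)⟩ : ↥N) ∈ I (n + 1) := by
    change y (n + 1) * (y (n + 1))⁻¹ ∈ O
    rw [mul_inv_cancel₀ (hy0 _)]; exact O.one_mem
  have hn' : I n = I (n + 1) := hn (n + 1) (Nat.le_succ n)
  rw [← hn'] at hmem
  exact hsep n hmem

/-- **NOETHERIAN CAPTURE, `Subalgebra` form** — the shape in which branch (b) of β1ʳ¹♯ supplies the capturing ring
(a noetherian `k`-subalgebra `N ⊆ O`, e.g. a generic-fibre regular stage of `…NoZenoGenericFibreStage`).
[OURS: ideator res-L0-w44-idea-1, Sketch r13 §r13.3 (`beta1RankOneSharp_of_capture`, capture branch)] -/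
theorem terminates_of_noetherianCapture_subalgebra (hD : StrictDrop) (p : ℕ) (hp : p.Prime) (k K : Type)
    [Field k] [CharP k p] [Field K] [Algebra k K] (O : ValuationSubring K) (A : Subalgebra k K)
    (hk : ∀ c : k, algebraMap k K c ∈ O) (hA : A.FG) (hfr : IsFractionRing ↥A K)
    (hAO : A.toSubring ≤ O.toSubring) (N : Subalgebra k K) (hN : IsNoetherianRing ↥N)
    (hNO : N.toSubring ≤ O.toSubring) (m₀ : ℕ)
    (hcap : ∀ m : ℕ, m₀ ≤ m → ∀ x ∈ ca (tower O A m), x ∈ N) :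
    ∃ m : ℕ, IsRegularLocalRing ↥(tower O A m) :=
  terminates_of_noetherianCapture hD p hp k K O A hk hA hfr hAO N.toSubring hN hNO m₀
    (fun m hm x hx => Subalgebra.mem_toSubring.mpr (hcap m hm x hx))

/-- **ESCAPE (contrapositive of noetherian capture).**  If no stage is regular, the conductors of the late stages
leave EVERY noetherian subring of `O` beyond every index — in particular (branch (b) of β1ʳ¹♯) every generic-fibre
regular ring `D ⊇ T_m`. [OURS: ideator res-L0-w44-idea-1, Sketch r13 §r13.2 `conductors_escape`] -/
theorem conductors_escape (hD : StrictDrop) (p : ℕ) (hp : p.Prime) (k K : Type) [Field k]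
    [CharP k p] [Field K] [Algebra k K] (O : ValuationSubring K) (A : Subalgebra k K)
    (hk : ∀ c : k, algebraMap k K c ∈ O) (hA : A.FG) (hfr : IsFractionRing ↥A K)
    (hAO : A.toSubring ≤ O.toSubring) (hnone : ∀ m : ℕ, ¬ IsRegularLocalRing ↥(tower O A m))
    (N : Subring K) (hN : IsNoetherianRing ↥N) (hNO : N ≤ O.toSubring) (m₀ : ℕ) :
    ∃ m : ℕ, m₀ ≤ m ∧ ∃ x ∈ ca (tower O A m), x ∉ N := by
  by_contra h
  push Not at h
  obtain ⟨m, hm⟩ := terminates_of_noetherianCapture hD p hp k K O A hk hA hfr hAO N hN hNO m₀ h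
  exact hnone m hm

/-- **The converse of noetherian capture is free**: a regular stage `T_m` is a noetherian `k`-subalgebra of `O`,
dominated by `O`, which contains every later stage (the tower is stationary after it) — in particular all late
conductors.  So re-cutting «∃ regular stage» as «∃ noetherian capturing subring» loses nothing.
[OURS: ideator res-L0-w44-idea-1, Sketch r13 §r13.3 `beta1SharpCapture_of_sharp`] -/
theorem capture_of_isRegularLocalRing_tower (O : ValuationSubring K) (A : Subalgebra k K)
    (hk : ∀ c : k, algebraMap k K c ∈ O) (hA : A.FG) (hfr : IsFractionRing ↥A K)
    (hAO : A.toSubring ≤ O.toSubring) (m : ℕ) (hreg : IsRegularLocalRing ↥(tower O A m)) :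
    IsNoetherianRing ↥(tower O A m) ∧ (tower O A m).toSubring ≤ O.toSubring ∧
      (∀ x ∈ tower O A m, x⁻¹ ∈ O → x⁻¹ ∈ tower O A m) ∧
      ∀ m' : ℕ, m ≤ m' → ∀ x ∈ tower O A m', x ∈ tower O A m := by
  refine ⟨stub_towerNoetherian k K O A hk hA hfr hAO m, fun x hx => TraceSocle.stage_le O A hk hAO m x hx,
    TraceSocle.inv_mem_stage O A hk hAO m, fun m' hm' x hx => ?_⟩
  rwa [tower_eq_of_le_of_isRegularLocalRing O A hk hfr hAO m hreg m' hm'] at hx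

/-! ## §r13.4 THE LADDER (unconditional): every stage is captured by a rung of the quadratic sequence along `O` of a
two-dimensional regular local ring dominated by `O`; under StrictDrop, NoZeno ⟺ BOUNDED CAPTURE INDEX -/

/-- A finite subset of `O = ⋃ R_i` (monotone union) lies in one member. [folklore] -/
theorem finset_subset_rung {O : ValuationSubring K} {R : ℕ → Subring K} (hmono : Monotone R)
    (hU : ∀ z : K, z ∈ O ↔ ∃ i, z ∈ R i) (S : Finset K) (hS : ∀ x ∈ S, x ∈ O) :
    ∃ i, ∀ x ∈ S, x ∈ R i := by
  classical
  induction S using Finset.induction_on with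
  | empty => exact ⟨0, by simp⟩
  | insert a S ha ih =>
    obtain ⟨i, hi⟩ := ih (fun x hx => hS x (Finset.mem_insert_of_mem hx))
    obtain ⟨j, hj⟩ := (hU a).mp (hS a (Finset.mem_insert_self a S))
    refine ⟨max i j, fun x hx => ?_⟩
    rcases Finset.mem_insert.mp hx with rfl | hx
    · exact hmono (le_max_right i j) hj
    · exact hmono (le_max_left i j) (hi x hx)

/-- **LADDER CAPTURE (unconditional).**  Let `R_0 → R_1 → ⋯` be the quadratic sequence along `O` of a
two-dimensional regular local ring `R_0 ∋ k` of `K` dominated by `O`.  Then EVERY stage `T_m` of the canonical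
normalised `ca`-tower lies in some rung `R_i` — the CAPTURE INDEX `i(m)` is defined.  (The stage is `k[S_m]`-fractions
with `O`-unit denominators for a finite `S_m ⊆ O` (tree `StrictDrop.Birth.TowerShape.stub_towerShape`); `S_m` sits in
one rung by Abhyankar's union lemma (tree `AbhyankarQuadraticUnion_holds`), and rungs are dominated by `O`.)
[OURS: ideator res-L0-w44-idea-1, Sketch r13 §r13.4; cite: Cutkosky2014, Lemma 2.2 (= Abhyankar 1956, Lemma 12)] -/
theorem stage_captured_by_rung (p : ℕ) (hp : p.Prime) (k K : Type)
    [Field k] [CharP k p] [Field K] [Algebra k K] (O : ValuationSubring K) (A : Subalgebra k K)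
    (hk : ∀ c : k, algebraMap k K c ∈ O) (hA : A.FG) (hfr : IsFractionRing ↥A K)
    (hAO : A.toSubring ≤ O.toSubring) (R : ℕ → Subring K) (hreg : IsRegularLocalRing ↥(R 0))
    (hdim : ringKrullDim ↥(R 0) = 2) (hof : IsLocalRingOf (R 0)) (hdomR : SubringDominates (R 0) O.toSubring)
    (hstep : ∀ i, IsQuadraticTransformAlong O (R i) (R (i + 1))) (hkR : ∀ c : k, algebraMap k K c ∈ R 0)
    (m : ℕ) : ∃ i : ℕ, ∀ x ∈ tower O A m, x ∈ R i := by
  classical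
  have hshape : (∃ B : Subalgebra k K, B.FG ∧ B ≤ tower O A m ∧
      loc O B = tower O A m ∧ ∀ x ∈ tower O A m, ∃ b ∈ B, ∃ s ∈ B, s⁻¹ ∈ O ∧ x = b * s⁻¹) ∧
      IsNoetherianRing ↥(tower O A m) ∧ (tower O A m).toSubring ≤ O.toSubring ∧
      ∀ s ∈ tower O A m, s⁻¹ ∈ O → s⁻¹ ∈ tower O A m :=
    StrictDrop.Birth.TowerShape.stub_towerShape p hp k K O A hk hA hfr hAO m
  obtain ⟨⟨B, ⟨SB, hSB⟩, hBT, -, hfrac⟩, -, hTO, -⟩ := hshape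
  have hmono : Monotone R := sequence_monotone hstep
  have hUz : ∀ z : K, z ∈ O ↔ ∃ i, z ∈ R i := AbhyankarQuadraticUnion_holds K O R hreg hdim hof hdomR hstep
  have hSBO : ∀ x ∈ SB, x ∈ O := fun x hx =>
    hTO (hBT (by rw [← hSB]; exact Algebra.subset_adjoin (Finset.mem_coe.mpr hx)))
  obtain ⟨i, hi⟩ := finset_subset_rung hmono hUz SB hSBO
  let Ri : Subalgebra k K :=
    { carrier := R i
      mul_mem' := fun ha hb => (R i).mul_mem ha hb
      one_mem' := (R i).one_mem
      add_mem' := fun ha hb => (R i).add_mem ha hb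
      zero_mem' := (R i).zero_mem
      algebraMap_mem' := fun c => hmono (Nat.zero_le i) (hkR c) }
  have hBR : B ≤ Ri := by
    rw [← hSB]
    exact Algebra.adjoin_le fun x hx => hi x (Finset.mem_coe.mp hx)
  refine ⟨i, fun x hx => ?_⟩
  obtain ⟨b, hb, s, hs, hsO, rfl⟩ := hfrac x hx
  have hdomi : SubringDominates (R i) O.toSubring := (sequence_dominates hdomR hstep i).1
  exact (R i).mul_mem (hBR hb) (hdomi.2 s (hBR hs) hsO)

/-- **NoZeno ⟺ BOUNDED CAPTURE INDEX (unconditional; under StrictDrop).**  With a ladder `R_•` as in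
`stage_captured_by_rung` (its rungs are regular local rings — tree `isRegularLocalRing_sequence` — hence noetherian),
the tower has a regular stage iff ONE rung contains all late stages.  (⇐) is NOETHERIAN CAPTURE
(`ca(T_m) ⊆ T_m ⊆ R_i`); (⇒) the regular stage is captured and the tower is stationary after it.
[OURS: ideator res-L0-w44-idea-1, Sketch r13 §r13.4; cite: Abhyankar1956Valuations, Lemma 12 and Prop. 8] -/
theorem terminates_iff_boundedCaptureIndex (hD : StrictDrop) (p : ℕ)
    (hp : p.Prime) (k K : Type) [Field k] [CharP k p] [Field K] [Algebra k K] (O : ValuationSubring K)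
    (A : Subalgebra k K) (hk : ∀ c : k, algebraMap k K c ∈ O) (hA : A.FG) (hfr : IsFractionRing ↥A K)
    (hAO : A.toSubring ≤ O.toSubring) (R : ℕ → Subring K) (hreg : IsRegularLocalRing ↥(R 0))
    (hdim : ringKrullDim ↥(R 0) = 2) (hof : IsLocalRingOf (R 0)) (hdomR : SubringDominates (R 0) O.toSubring)
    (hstep : ∀ i, IsQuadraticTransformAlong O (R i) (R (i + 1))) (hkR : ∀ c : k, algebraMap k K c ∈ R 0) :
    (∃ m : ℕ, IsRegularLocalRing ↥(tower O A m)) ↔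
      ∃ i m₀ : ℕ, ∀ m : ℕ, m₀ ≤ m → ∀ x ∈ tower O A m, x ∈ R i := by
  constructor
  · rintro ⟨m, hm⟩
    obtain ⟨i, hi⟩ := stage_captured_by_rung p hp k K O A hk hA hfr hAO R hreg hdim hof hdomR hstep hkR m
    refine ⟨i, m, fun m' hm' x hx => hi x ?_⟩
    rwa [tower_eq_of_le_of_isRegularLocalRing O A hk hfr hAO m hm m' hm'] at hx
  · rintro ⟨i, m₀, hcap⟩
    have hRiO : R i ≤ O.toSubring := (sequence_dominates hdomR hstep i).1.1
    haveI : IsRegularLocalRing ↥(R i) := isRegularLocalRing_sequence hreg hstep i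
    have hRN : IsNoetherianRing ↥(R i) := inferInstance
    exact terminates_of_noetherianCapture hD p hp k K O A hk hA hfr hAO (R i) hRN hRiO m₀
      (fun m hm x hx => hcap m hm x (ca_subset _ hx))

end Summit.ResolutionOfSingularities.ResolutionOfSingularities.Theorems.NoZeno.NoetherianCapture

end
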